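import Literature.NumberTheory.PAdicHodge.LubinTateCharacterConjugatesGeneral
import Literature.NumberTheory.PAdicHodge.EisensteinCoeffSurjective
import Mathlib.RingTheory.WittVector.Complete
import HarnessLib

/-!
# `𝒪_F = W(k_F)[π]`: every uniformizer of a `p`-adic field is the root of an Eisenstein polynomial over `W(k_F)`,
# and the Lubin–Tate characters of `F` are `ℂ_F`-admissible after every `ℚ_p`-embedding (hypothesis (H), all `F`)

Topic `Literature/NumberTheory/PAdicHodge` (solo-Langlands-informed Stage E2.11–E2.12, memo `work/s113/E29.md` §7).
Let `F/ℚ_p` be a `p`-adic field (`|p|_F < 1`), `π` a uniformizer, `k_F` its residue field, `k̄` the residue field of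
`𝒪̂_{F^nr}`, `W(k_F) = W(k̄)^{Γ_F}` (`wittFixed F p`) with its embedding `ι : W(k_F) → 𝒪_F` (`wittFixedToInt`), and
`[a] ∈ W(k_F)` the Teichmüller lift of `a ∈ k_F` (`teichmullerFixed`).  This file proves the structure theorem
**`𝒪_F = W(k_F)[π] ≅ W(k_F)[X]/(E)` with `E` Eisenstein** (Serre, *Local Fields*, II §5 Thm. 4 + I §6 Prop. 18) in the
form consumed by the tree's `EisensteinRootW` data, and deduces hypothesis **(H)** of the `GL₁` files for EVERY `F`:

* §0 `W(k_F)` is `p`-adically complete: a sequence with `f(k+1) ≡ f(k) (mod pᵏ)` has a limit (`WittFixedLimit.exists_limit`;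
  Mathlib's `p`-adic completeness of `W(k̄)`, the limit being `Γ_F`-fixed because `⋂ pᵏW(k̄) = 0`).
* §1 digits: `ι[a] ≡ a (mod 𝔪_F)` (`residue_wittFixedToInt_teichmullerFixed`), so `x = ι[x̄] + π x'`
  (`exists_eq_teichmuller_add_mul`); §2 `p = π^e · u` with `e ≥ 1`, `u ∈ 𝒪_F^×` (`exists_natCast_eq_pow_mul`).
* §3–§4 the `π`-adic digit expansion `x = Σ_{i<e} ι(zᵢ) πⁱ + p x'` (`WittDigits.exists_digits`), iterated `p`-adically and
  passed to the limit: **every `x ∈ 𝒪_F` is `Σ_{i<e} ι(Lᵢ) πⁱ` with `Lᵢ ∈ W(k_F)`** (`WittDigits.exists_eq_ofDigits`).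
* §5 ★ `exists_eisensteinRootW`: expanding `u⁻¹ = Σ_{i<e} ι(dᵢ) πⁱ` gives `π^e = Σ_{i<e} ι(p dᵢ) πⁱ`, i.e. `π` is a root of the
  monic `E = X^e − Σ_{i<e} p dᵢ Xⁱ ∈ W(k_F)[X]`, which is Eisenstein (`d₀` is a unit since `ι(d₀) ≡ u⁻¹ (mod π)`, and a fixed
  Witt vector with unit image is a unit, `isUnit_of_isUnit_wittFixedToInt`); and `W(k_F)[X]/(E) → 𝒪_F` is onto by §4.
  ★★ `lubinTateCharacterConjugateAdmissible_holds`: with `lubinTateCharacterConjugateAdmissible_of_coeff_surjective'`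
  (tree), **(H) `LubinTateCharacterConjugateAdmissible F p hp hπ` holds for every `p`-adic field `F`, every `p` with
  `|p|_F < 1` and every uniformizer `π`** — every `ℚ_p`-conjugate `e ∘ χ_π` of the Lubin–Tate character is `ℂ_F`-admissible
  on an open subgroup.

Definitions (reviewed): `WittDigits.ofDigits`, `WittDigits.digitSeq`. No named facts, no instances, no `sorry`.

## References
* J.-P. Serre, *Local Fields* (GTM 67, 1979), Ch. I §6 Prop. 17–18, Ch. II §5 Thm. 3–4, §6 Thm. 7. [SerreLocalFields1979]
* J.-P. Serre, *Abelian ℓ-adic representations and elliptic curves* (1968), Ch. III §A.4–A.5. [SerreAbelianLadic1968]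
* J.-M. Fontaine, *Le corps des périodes p-adiques*, Astérisque 223 (1994), Exp. II §1.2, §1.5. [FontaineAsterisque223III]
-/

noncomputable section

open IsLocalRing WittVector Polynomial

namespace Literature.NumberTheory.PAdicHodge

open Literature.NumberTheory.GaloisRepresentations
open Literature.NumberTheory.GaloisRepresentations.IsNonarchimedeanLocalField
open Field ValuativeRel

variable {F : Type} [Field F] [ValuativeRel F] [TopologicalSpace F] [IsNonarchimedeanLocalField F] [CharZero F]
  {p : ℕ} [Fact p.Prime]

/-! ## §0 `W(k_F)` is `p`-adically complete (successive-difference form) -/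

namespace WittFixedLimit

omit [CharZero F] in
set_option maxHeartbeats 2000000 in
/-- **A `p`-adically Cauchy sequence in `W(k_F)` converges in `W(k_F)`**: if `f(k+1) ≡ f(k) (mod pᵏ)` for all `k` then
there is `L ∈ W(k_F)` with `L ≡ f(k) (mod pᵏ)` for all `k`.  (`W(k̄)` is `p`-adically complete — Mathlib — and the limit
`L` is `Γ_F`-fixed because `σL − L ∈ ⋂ₖ pᵏ W(k̄) = 0`; the quotients `(L − f(k))/pᵏ` are fixed as `W(k̄)` is `p`-torsion-free.)
[cite: SerreLocalFields1979, Ch. II §5 Thm. 3–4, §6 Thm. 7] -/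
theorem exists_limit (hp : valuation F p < 1) (f : ℕ → wittFixed F p)
    (hf : ∀ k, f (k + 1) - f k ∈ Ideal.span {(p : wittFixed F p) ^ k}) :
    ∃ L : wittFixed F p, ∀ k, L - f k ∈ Ideal.span {(p : wittFixed F p) ^ k} := by
  haveI : Fact (¬ IsUnit (p : maxUnramifiedCompletion F)) := ⟨not_isUnit_natCast_completion hp⟩
  haveI : CharP (ResidueField (maxUnramifiedCompletion F)) p := charP_residueField_completion
  haveI : PerfectRing (ResidueField (maxUnramifiedCompletion F)) p := perfectRing_residueField_completion
  set g : ℕ → WittVector p (ResidueField (maxUnramifiedCompletion F)) :=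
    fun k => (f k : WittVector p (ResidueField (maxUnramifiedCompletion F))) with hg
  have hg' : ∀ k, g (k + 1) - g k ∈ Ideal.span {(p : WittVector p (ResidueField (maxUnramifiedCompletion F))) ^ k} := by
    intro k
    obtain ⟨a, ha⟩ := Ideal.mem_span_singleton'.1 (hf k)
    refine Ideal.mem_span_singleton'.2 ⟨(a : WittVector p (ResidueField (maxUnramifiedCompletion F))), ?_⟩
    have h := congrArg ((↑) : wittFixed F p → WittVector p (ResidueField (maxUnramifiedCompletion F))) ha
    simpa [hg] using h
  have hI : ∀ k, ((Ideal.span {(p : WittVector p (ResidueField (maxUnramifiedCompletion F)))}) ^ k • ⊤ :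
      Submodule (WittVector p (ResidueField (maxUnramifiedCompletion F)))
        (WittVector p (ResidueField (maxUnramifiedCompletion F)))) =
      Ideal.span {(p : WittVector p (ResidueField (maxUnramifiedCompletion F))) ^ k} := by
    intro k
    rw [smul_eq_mul, Ideal.mul_top, Ideal.span_singleton_pow]
  obtain ⟨L, hL⟩ := IsPrecomplete.prec' (I := Ideal.span {(p : WittVector p (ResidueField (maxUnramifiedCompletion F)))}) g
    (fun {m n} hmn => by
      rw [SModEq.sub_mem, hI]
      have h := PadicIntLimit.sub_mem_of_succ_sub_mem (p : WittVector p (ResidueField (maxUnramifiedCompletion F))) g hg' hmn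
      rwa [← Ideal.neg_mem_iff, neg_sub] at h)
  have hL' : ∀ k, L - g k ∈ Ideal.span {(p : WittVector p (ResidueField (maxUnramifiedCompletion F))) ^ k} := by
    intro k
    have h := hL k
    rw [SModEq.sub_mem, hI] at h
    rwa [← Ideal.neg_mem_iff, neg_sub] at h
  -- `L` is `Γ_F`-fixed: `σL − L ∈ ⋂ₖ (pᵏ) = 0`
  have hLfix : L ∈ wittFixed F p := by
    refine mem_wittFixed_iff.2 fun σ => ?_
    refine sub_eq_zero.1 (IsHausdorff.haus' (I := Ideal.span {(p : WittVector p (ResidueField (maxUnramifiedCompletion F)))})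
      (wittGal σ L - L) fun k => ?_)
    rw [SModEq.sub_mem, sub_zero, hI]
    have h1 : wittGal σ L - L = wittGal σ (L - g k) - (L - g k) := by
      rw [map_sub, hg]
      simp only [wittGal_coe_wittFixed]
      ring
    rw [h1]
    refine Ideal.sub_mem _ ?_ (hL' k)
    obtain ⟨a, ha⟩ := Ideal.mem_span_singleton'.1 (hL' k)
    refine Ideal.mem_span_singleton'.2 ⟨wittGal σ a, ?_⟩
    rw [← ha, map_mul, map_pow, map_natCast]
  refine ⟨⟨L, hLfix⟩, fun k => ?_⟩
  -- transfer the congruence back to the subring `W(k_F)`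
  obtain ⟨a, ha⟩ := Ideal.mem_span_singleton'.1 (hL' k)
  have hafix : a ∈ wittFixed F p := by
    refine mem_wittFixed_iff.2 fun σ => ?_
    have h1 : wittGal σ (a * (p : WittVector p (ResidueField (maxUnramifiedCompletion F))) ^ k) =
        a * (p : WittVector p (ResidueField (maxUnramifiedCompletion F))) ^ k := by
      rw [ha, map_sub, (mem_wittFixed_iff.1 hLfix) σ, hg]
      simp only [wittGal_coe_wittFixed]
    rw [map_mul, map_pow, map_natCast] at h1
    exact mul_right_cancel₀ (pow_ne_zero k (WittVector.p_nonzero p (ResidueField (maxUnramifiedCompletion F)))) h1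
  refine Ideal.mem_span_singleton'.2 ⟨⟨a, hafix⟩, Subtype.ext ?_⟩
  rw [Subring.coe_mul, SubmonoidClass.coe_pow, Subring.coe_natCast, AddSubgroupClass.coe_sub, ha, hg]

end WittFixedLimit

/-! ## §1 Teichmüller digits: `ι[a] ≡ a (mod 𝔪_F)`, `x = ι[x̄] + π x'` -/

/-- **`ι[a]` reduces to `a`**: the image in `𝒪_F` of the Teichmüller lift `[a] ∈ W(k_F)` of `a ∈ k_F` has residue `a`
(compare residues in `𝒪̂_{F^nr}`, where `ι[a]` and the image of `[a] ∈ W(k̄)` coincide and the latter has residue `a`).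
[cite: SerreLocalFields1979, Ch. II §4 Prop. 8, §5 Thm. 4] -/
theorem residue_wittFixedToInt_teichmullerFixed (hp : valuation F p < 1) (a : 𝓀[F]) :
    IsLocalRing.residue 𝒪[F] (wittFixedToInt F p hp (teichmullerFixed F p a)) = a := by
  haveI : Fact (¬ IsUnit (p : maxUnramifiedCompletion F)) := ⟨not_isUnit_natCast_completion hp⟩
  haveI : CharP (ResidueField (maxUnramifiedCompletion F)) p := charP_residueField_completion
  haveI : IsAdicComplete (Ideal.span {(p : maxUnramifiedCompletion F)}) (maxUnramifiedCompletion F) :=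
    isAdicComplete_span_natCast_completion hp (Fact.out : p.Prime).ne_zero
  haveI : Fact (¬ IsUnit (p : integerC F)) := ⟨not_isUnit_natCast_integerC hp⟩
  haveI : IsAdicComplete (Ideal.span {(p : integerC F)}) (integerC F) := isAdicComplete_integerC_natCast hp
  apply residueFieldEmb_injective
  rw [residueFieldEmb_residue]
  have hmem : algebraMap 𝒪[F] (maxUnramifiedCompletion F) (wittFixedToInt F p hp (teichmullerFixed F p a)) -
      wittToCompletion F p (teichmuller p (residueFieldEmb F a)) ∈ maximalIdeal (maxUnramifiedCompletion F) := by
    apply mem_maximalIdeal_of_norm_toC_lt_one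
    rw [map_sub, toC_algebraMap, coe_wittFixedToInt, algebraMap_wittFixedToF, coe_teichmullerFixed,
      ← wittToC_eq_toC_wittToCompletion hp, sub_self, norm_zero]
    exact one_pos
  have h := (IsLocalRing.residue_eq_zero_iff _).2 hmem
  rw [map_sub, sub_eq_zero, residue_wittToCompletion_teichmuller] at h
  exact h

/-- **First `π`-adic digit**: every `x ∈ 𝒪_F` is `ι[a] + π·x'` with `a = x̄ ∈ k_F` (`π` any uniformizer).
[cite: SerreLocalFields1979, Ch. II §5 Thm. 4, Ch. I §6 Prop. 18] -/
theorem exists_eq_teichmuller_add_mul (hp : valuation F p < 1) {π : 𝒪[F]} (hπ : (valuation F).IsUniformizer (π : F))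
    (x : 𝒪[F]) : ∃ a : 𝓀[F], ∃ x' : 𝒪[F], x = wittFixedToInt F p hp (teichmullerFixed F p a) + π * x' := by
  have hmem : x - wittFixedToInt F p hp (teichmullerFixed F p (IsLocalRing.residue 𝒪[F] x)) ∈ 𝓂[F] := by
    rw [← IsLocalRing.residue_eq_zero_iff, map_sub, residue_wittFixedToInt_teichmullerFixed, sub_self]
  obtain ⟨x', hx'⟩ := dvd_of_mem_maximalIdeal F hπ hmem
  exact ⟨IsLocalRing.residue 𝒪[F] x, x', by rw [← hx', add_sub_cancel]⟩

/-! ## §2 `p = π^e · u` -/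

/-- **`p = π^e·u` with `e ≥ 1` and `u ∈ 𝒪_F^×** for every uniformizer `π` (`e` is the absolute ramification index):
divide `p` by `π` as long as the quotient is a non-unit; this stops after at most `N` steps, `‖π‖^N < ‖p‖`.
[cite: SerreLocalFields1979, Ch. I §6 Prop. 18, Ch. II §5] -/
theorem exists_natCast_eq_pow_mul (hp : valuation F p < 1) {π : 𝒪[F]} (hπ : (valuation F).IsUniformizer (π : F)) :
    ∃ e : ℕ, 0 < e ∧ ∃ u : (𝒪[F])ˣ, (p : 𝒪[F]) = π ^ e * u := by
  letI := nontriviallyNormedField F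
  have hπ1 : ‖(π : F)‖ < 1 := (norm_lt_one_iff F (π : F)).2 hπ.val_lt_one
  have hp0 : 0 < ‖((p : 𝒪[F]) : F)‖ := by
    rw [norm_pos_iff]
    exact_mod_cast (Nat.cast_ne_zero.2 (Fact.out : p.Prime).ne_zero : (p : F) ≠ 0)
  obtain ⟨N, hN⟩ := exists_pow_lt_of_lt_one hp0 hπ1
  have key : ∀ n : ℕ, (∃ y : 𝒪[F], (p : 𝒪[F]) = π ^ n * y) ∨
      (∃ e ≤ n, ∃ u : 𝒪[F], IsUnit u ∧ (p : 𝒪[F]) = π ^ e * u) := by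
    intro n
    induction n with
    | zero => exact Or.inl ⟨p, by rw [pow_zero, one_mul]⟩
    | succ n ih =>
      rcases ih with ⟨y, hy⟩ | ⟨e, he, u, hu, h⟩
      · by_cases hyu : IsUnit y
        · exact Or.inr ⟨n, n.le_succ, y, hyu, hy⟩
        · obtain ⟨y', hy'⟩ := dvd_of_mem_maximalIdeal F hπ ((IsLocalRing.mem_maximalIdeal y).2 hyu)
          exact Or.inl ⟨y', by rw [hy, hy', pow_succ, mul_assoc]⟩
      · exact Or.inr ⟨e, he.trans n.le_succ, u, hu, h⟩
  rcases key N with ⟨y, hy⟩ | ⟨e, -, u, hu, h⟩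
  · exfalso
    have h1 : ‖((p : 𝒪[F]) : F)‖ ≤ ‖(π : F)‖ ^ N := by
      have h2 : ((p : 𝒪[F]) : F) = (π : F) ^ N * (y : F) := by rw [hy]; push_cast; ring
      rw [h2, norm_mul, norm_pow]
      exact mul_le_of_le_one_right (pow_nonneg (norm_nonneg _) _) ((norm_le_one_iff F (y : F)).2 y.2)
    exact absurd (h1.trans_lt hN) (lt_irrefl _)
  · refine ⟨e, Nat.pos_of_ne_zero ?_, hu.unit, by rw [IsUnit.unit_spec]; exact h⟩
    rintro rfl
    rw [pow_zero, one_mul] at h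
    have hpm : (p : 𝒪[F]) ∈ 𝓂[F] := (mem_maximalIdeal_iff_valuation_lt_one _).2 hp
    exact (IsLocalRing.mem_maximalIdeal _).1 hpm (h ▸ hu)

/-! ## §3 Digit sums `Σ_{i<e} ι(zᵢ) πⁱ` and digits modulo `p` -/

namespace WittDigits

/-- The digit sum `Σ_{i<e} ι(zᵢ) πⁱ ∈ 𝒪_F` of a digit vector `z : ℕ → W(k_F)` (only `z₀, …, z_{e−1}` matter). [folklore] -/
def ofDigits (hp : valuation F p < 1) (π : 𝒪[F]) (e : ℕ) (z : ℕ → wittFixed F p) : 𝒪[F] :=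
  ∑ i ∈ Finset.range e, wittFixedToInt F p hp (z i) * π ^ i

/-- `ofDigits` is additive. [cite: SerreLocalFields1979, Ch. II §5 Thm. 4] -/
theorem ofDigits_add (hp : valuation F p < 1) (π : 𝒪[F]) (e : ℕ) (z w : ℕ → wittFixed F p) :
    ofDigits hp π e (z + w) = ofDigits hp π e z + ofDigits hp π e w := by
  simp only [ofDigits, Pi.add_apply, map_add, add_mul, Finset.sum_add_distrib]

/-- `ofDigits` is compatible with subtraction. [cite: SerreLocalFields1979, Ch. II §5 Thm. 4] -/
theorem ofDigits_sub (hp : valuation F p < 1) (π : 𝒪[F]) (e : ℕ) (z w : ℕ → wittFixed F p) :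
    ofDigits hp π e (z - w) = ofDigits hp π e z - ofDigits hp π e w := by
  simp only [ofDigits, Pi.sub_apply, map_sub, sub_mul, Finset.sum_sub_distrib]

set_option maxHeartbeats 2000000 in
/-- `ofDigits (pᵏ·z) = pᵏ·ofDigits z`. [cite: SerreLocalFields1979, Ch. II §5 Thm. 4] -/
theorem ofDigits_natCast_pow_mul (hp : valuation F p < 1) (π : 𝒪[F]) (e k : ℕ) (z : ℕ → wittFixed F p) :
    ofDigits hp π e (fun i => (p : wittFixed F p) ^ k * z i) = (p : 𝒪[F]) ^ k * ofDigits hp π e z := by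
  simp only [ofDigits, map_mul, map_pow, map_natCast, Finset.mul_sum, mul_assoc]

set_option maxHeartbeats 2000000 in
/-- `ofDigits z ∈ (pᵏ)` when every `zᵢ ∈ (pᵏ)`. [cite: SerreLocalFields1979, Ch. II §5 Thm. 4] -/
theorem ofDigits_mem (hp : valuation F p < 1) (π : 𝒪[F]) (e k : ℕ) {z : ℕ → wittFixed F p}
    (hz : ∀ i, z i ∈ Ideal.span {(p : wittFixed F p) ^ k}) : ofDigits hp π e z ∈ Ideal.span {(p : 𝒪[F]) ^ k} := by
  unfold ofDigits
  refine Ideal.sum_mem _ fun i _ => ?_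
  obtain ⟨w, hw⟩ := Ideal.mem_span_singleton'.1 (hz i)
  rw [← hw, map_mul, map_pow, map_natCast]
  exact Ideal.mul_mem_right _ _ (Ideal.mul_mem_left _ _ (Ideal.mem_span_singleton_self _))

/-- **Digits modulo `p`**: if `p = π^e·u` then every `c ∈ 𝒪_F` is `Σ_{i<e} ι[aᵢ] πⁱ + p·c'` (`e` first-digit steps
`c = ι[a] + π c'`). [cite: SerreLocalFields1979, Ch. II §5 Thm. 4, Ch. I §6 Prop. 18] -/
theorem exists_digits (hp : valuation F p < 1) {π : 𝒪[F]} (hπ : (valuation F).IsUniformizer (π : F)) {e : ℕ}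
    {u : (𝒪[F])ˣ} (hpe : (p : 𝒪[F]) = π ^ e * u) (c : 𝒪[F]) :
    ∃ n : ℕ → wittFixed F p, ∃ c' : 𝒪[F], c = ofDigits hp π e n + (p : 𝒪[F]) * c' := by
  have key : ∀ j : ℕ, ∃ n : ℕ → wittFixed F p, ∃ c' : 𝒪[F], c = ofDigits hp π j n + π ^ j * c' := by
    intro j
    induction j with
    | zero => exact ⟨fun _ => 0, c, by simp [ofDigits]⟩
    | succ j ih =>
      obtain ⟨n, c', hc⟩ := ih
      obtain ⟨a, c'', hc'⟩ := exists_eq_teichmuller_add_mul hp hπ c'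
      refine ⟨Function.update n j (teichmullerFixed F p a), c'', ?_⟩
      rw [ofDigits, Finset.sum_range_succ, Function.update_self,
        Finset.sum_congr rfl fun i hi => by rw [Function.update_of_ne (Finset.mem_range.1 hi).ne], hc, hc', ofDigits]
      ring
  obtain ⟨n, c', hc⟩ := key e
  refine ⟨n, ((u⁻¹ : (𝒪[F])ˣ) : 𝒪[F]) * c', ?_⟩
  rw [hc, hpe, mul_assoc, ← mul_assoc (u : 𝒪[F]), Units.mul_inv, one_mul]

/-! ## §4 The `p`-adic digit expansion and its limit: `𝒪_F = Σ_{i<e} ι(W(k_F)) πⁱ` -/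

/-- The digit recursion: `(z⁽ᵏ⁾, c_k)` with `b = ofDigits z⁽ᵏ⁾ + pᵏ c_k`, `z⁽⁰⁾ = 0`, `c₀ = b`,
`z⁽ᵏ⁺¹⁾ = z⁽ᵏ⁾ + pᵏ·(digits of c_k)`. [folklore] -/
def digitSeq (hp : valuation F p < 1) {π : 𝒪[F]} (hπ : (valuation F).IsUniformizer (π : F)) {e : ℕ}
    {u : (𝒪[F])ˣ} (hpe : (p : 𝒪[F]) = π ^ e * u) (b : 𝒪[F]) : ℕ → (ℕ → wittFixed F p) × 𝒪[F]
  | 0 => (0, b)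
  | k + 1 =>
    ((digitSeq hp hπ hpe b k).1 + fun i => (p : wittFixed F p) ^ k * Classical.choose (exists_digits hp hπ hpe (digitSeq hp hπ hpe b k).2) i,
      Classical.choose (Classical.choose_spec (exists_digits hp hπ hpe (digitSeq hp hπ hpe b k).2)))

/-- The invariant of the digit recursion: `b = ofDigits z⁽ᵏ⁾ + pᵏ·c_k`. [cite: SerreLocalFields1979, Ch. II §5 Thm. 4] -/
theorem digitSeq_spec (hp : valuation F p < 1) {π : 𝒪[F]} (hπ : (valuation F).IsUniformizer (π : F)) {e : ℕ}
    {u : (𝒪[F])ˣ} (hpe : (p : 𝒪[F]) = π ^ e * u) (b : 𝒪[F]) (k : ℕ) :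
    b = ofDigits hp π e (digitSeq hp hπ hpe b k).1 + (p : 𝒪[F]) ^ k * (digitSeq hp hπ hpe b k).2 := by
  induction k with
  | zero => simp [digitSeq, ofDigits]
  | succ k ih =>
    have hs := Classical.choose_spec (Classical.choose_spec (exists_digits hp hπ hpe (digitSeq hp hπ hpe b k).2))
    change b = ofDigits hp π e ((digitSeq hp hπ hpe b k).1 + fun i =>
        (p : wittFixed F p) ^ k * Classical.choose (exists_digits hp hπ hpe (digitSeq hp hπ hpe b k).2) i) +
      (p : 𝒪[F]) ^ (k + 1) * Classical.choose (Classical.choose_spec (exists_digits hp hπ hpe (digitSeq hp hπ hpe b k).2))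
    rw [ofDigits_add, ofDigits_natCast_pow_mul, add_assoc, pow_succ, mul_assoc, ← mul_add, ← hs]
    exact ih

/-- The digit vectors are `p`-adically Cauchy: `z⁽ᵏ⁺¹⁾ᵢ − z⁽ᵏ⁾ᵢ ∈ (pᵏ)`. [cite: SerreLocalFields1979, Ch. II §5 Thm. 4] -/
theorem digitSeq_succ_sub (hp : valuation F p < 1) {π : 𝒪[F]} (hπ : (valuation F).IsUniformizer (π : F)) {e : ℕ}
    {u : (𝒪[F])ˣ} (hpe : (p : 𝒪[F]) = π ^ e * u) (b : 𝒪[F]) (k i : ℕ) :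
    (digitSeq hp hπ hpe b (k + 1)).1 i - (digitSeq hp hπ hpe b k).1 i ∈ Ideal.span {(p : wittFixed F p) ^ k} := by
  change ((digitSeq hp hπ hpe b k).1 + fun i =>
      (p : wittFixed F p) ^ k * Classical.choose (exists_digits hp hπ hpe (digitSeq hp hπ hpe b k).2) i) i -
    (digitSeq hp hπ hpe b k).1 i ∈ _
  rw [Pi.add_apply, add_sub_cancel_left]
  exact Ideal.mul_mem_right _ _ (Ideal.mem_span_singleton_self _)

/-- ★ **`𝒪_F = Σ_{i<e} ι(W(k_F))·πⁱ`**: every `b ∈ 𝒪_F` is a digit sum `Σ_{i<e} ι(Lᵢ) πⁱ` with `Lᵢ = lim z⁽ᵏ⁾ᵢ ∈ W(k_F)`,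
since `b − Σᵢ ι(Lᵢ) πⁱ ∈ ⋂ₖ pᵏ𝒪_F = 0`. [cite: SerreLocalFields1979, Ch. II §5 Thm. 4, Ch. I §6 Prop. 18] -/
theorem exists_eq_ofDigits (hp : valuation F p < 1) {π : 𝒪[F]} (hπ : (valuation F).IsUniformizer (π : F)) {e : ℕ}
    {u : (𝒪[F])ˣ} (hpe : (p : 𝒪[F]) = π ^ e * u) (b : 𝒪[F]) : ∃ L : ℕ → wittFixed F p, b = ofDigits hp π e L := by
  have hlim : ∀ i, ∃ L : wittFixed F p, ∀ k, L - (digitSeq hp hπ hpe b k).1 i ∈ Ideal.span {(p : wittFixed F p) ^ k} :=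
    fun i => WittFixedLimit.exists_limit hp _ fun k => digitSeq_succ_sub hp hπ hpe b k i
  choose L hL using hlim
  refine ⟨L, ?_⟩
  have hp𝓂 : (p : 𝒪[F]) ∈ 𝓂[F] := (mem_maximalIdeal_iff_valuation_lt_one _).2 hp
  refine (sub_eq_zero.1 (IsHausdorff.haus' (I := 𝓂[F]) (b - ofDigits hp π e L) fun k => ?_))
  rw [SModEq.sub_mem, sub_zero, smul_eq_mul, Ideal.mul_top]
  have hk : b - ofDigits hp π e L =
      (p : 𝒪[F]) ^ k * (digitSeq hp hπ hpe b k).2 - ofDigits hp π e (L - (digitSeq hp hπ hpe b k).1) := by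
    rw [ofDigits_sub]
    conv_lhs => rw [digitSeq_spec hp hπ hpe b k]
    ring
  rw [hk]
  have hsub : Ideal.span {(p : 𝒪[F]) ^ k} ≤ 𝓂[F] ^ k := by
    rw [Ideal.span_singleton_le_iff_mem]
    exact Ideal.pow_mem_pow hp𝓂 k
  exact hsub (Ideal.sub_mem _ (Ideal.mul_mem_right _ _ (Ideal.mem_span_singleton_self _))
    (ofDigits_mem hp π e k fun i => hL i k))

end WittDigits

/-! ## §5 The Eisenstein datum of a uniformizer and (H) for every `F` -/

set_option maxHeartbeats 2000000 in
/-- **A fixed Witt vector whose image in `𝒪_F` is a unit is a unit of `W(k_F)`**: otherwise its zeroth component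
vanishes, so it is `p·y` with `y ∈ W(k_F)` and its image lies in `p𝒪_F ⊆ 𝔪_F`. [cite: SerreLocalFields1979, Ch. II §5 Thm. 3–4, §6 Thm. 7] -/
theorem isUnit_of_isUnit_wittFixedToInt (hp : valuation F p < 1) {w : wittFixed F p}
    (hw : IsUnit (wittFixedToInt F p hp w)) : IsUnit w := by
  haveI : Fact (¬ IsUnit (p : maxUnramifiedCompletion F)) := ⟨not_isUnit_natCast_completion hp⟩
  haveI : CharP (ResidueField (maxUnramifiedCompletion F)) p := charP_residueField_completion
  haveI : PerfectRing (ResidueField (maxUnramifiedCompletion F)) p := perfectRing_residueField_completion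
  by_contra hnu
  have h0 : (w : WittVector p (ResidueField (maxUnramifiedCompletion F))).coeff 0 = 0 := by
    by_contra h0
    exact hnu (wittFixed_isUnit_of_isUnit_coe w (WittVector.isUnit_of_coeff_zero_ne_zero _ h0))
  obtain ⟨y, hy⟩ := exists_coe_eq_teichmuller_add_natCast_mul hp w
  rw [h0, teichmuller_zero, zero_add] at hy
  have hw' : w = (p : wittFixed F p) * y := Subtype.ext (by rw [Subring.coe_mul, Subring.coe_natCast]; exact hy)
  have hpm : (p : 𝒪[F]) ∈ 𝓂[F] := (mem_maximalIdeal_iff_valuation_lt_one _).2 hp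
  have hmem : wittFixedToInt F p hp w ∈ 𝓂[F] := by
    rw [hw', map_mul, map_natCast]
    exact Ideal.mul_mem_right _ _ hpm
  exact (IsLocalRing.mem_maximalIdeal _).1 hmem hw

set_option maxHeartbeats 2000000 in
/-- **`W(k_F)[X]/(E) → 𝒪_F` is onto as soon as every element of `𝒪_F` is a digit sum `Σ_{i<e} ι(Lᵢ) ϖⁱ`** in the root
`ϖ` of the datum (`Σᵢ Lᵢ Xⁱ ↦ Σᵢ ι(Lᵢ) ϖⁱ`). [cite: SerreLocalFields1979, Ch. I §6 Prop. 18] -/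
theorem EisensteinRootW.coeff_toInt_surjective_of_ofDigits {hp : valuation F p < 1} (D : EisensteinRootW F p hp)
    {π : 𝒪[F]} (hπD : (π : F) = D.unif) {e : ℕ} (h : ∀ b : 𝒪[F], ∃ L : ℕ → wittFixed F p, b = WittDigits.ofDigits hp π e L) :
    Function.Surjective (EisensteinRootW.Coeff.toInt D) := by
  intro b
  obtain ⟨L, hL⟩ := h b
  refine ⟨AdjoinRoot.mk D.poly (∑ i ∈ Finset.range e, C (L i) * X ^ i), Subtype.ext ?_⟩
  rw [EisensteinRootW.Coeff.coe_toInt, EisensteinRootW.Coeff.toF_mk, ← hπD, eval₂_finsetSum, hL, WittDigits.ofDigits]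
  push_cast
  simp only [eval₂_mul, eval₂_C, eval₂_X_pow, coe_wittFixedToInt]

set_option maxHeartbeats 4000000 in
/-- ★ **Every uniformizer `π` of `F` is the root of an Eisenstein polynomial `E ∈ W(k_F)[X]` with `𝒪_F = W(k_F)[π]`**:
writing `p = π^e u` and `u⁻¹ = Σ_{i<e} ι(dᵢ) πⁱ` (§4), `E := X^e − Σ_{i<e} p dᵢ Xⁱ` is monic of degree `e` with
`E(π) = π^e − p u⁻¹ = 0`, `p ∣ p dᵢ`, and `d₀ ∈ W(k_F)^×` (as `ι(d₀) ≡ u⁻¹ (mod π)` is a unit); the evaluation map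
`W(k_F)[X]/(E) → 𝒪_F` is onto by §4.  Packaged as an `EisensteinRootW` datum with root `π`.
[cite: SerreLocalFields1979, Ch. II §5 Thm. 4, Ch. I §6 Prop. 18] -/
theorem exists_eisensteinRootW (hp : valuation F p < 1) {π : 𝒪[F]} (hπ : (valuation F).IsUniformizer (π : F)) :
    ∃ D : EisensteinRootW F p hp, D.unif = (π : F) ∧ Function.Surjective (EisensteinRootW.Coeff.toInt D) := by
  obtain ⟨e, he, u, hpe⟩ := exists_natCast_eq_pow_mul hp hπ
  have hπm : π ∈ 𝓂[F] := (mem_maximalIdeal_iff_valuation_lt_one _).2 hπ.val_lt_one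
  -- `u⁻¹ = Σ_{i<e} ι(dᵢ) πⁱ`
  obtain ⟨d, hd⟩ := WittDigits.exists_eq_ofDigits hp hπ hpe ((u⁻¹ : (𝒪[F])ˣ) : 𝒪[F])
  have hπe : π ^ e = (p : 𝒪[F]) * ((u⁻¹ : (𝒪[F])ˣ) : 𝒪[F]) := by rw [hpe, mul_assoc, Units.mul_inv, mul_one]
  -- the polynomial `E = X^e − Σ_{i<e} (p dᵢ) Xⁱ`
  obtain ⟨q, hq⟩ : ∃ q : (wittFixed F p)[X], q = ∑ i ∈ Finset.range e, C ((p : wittFixed F p) * d i) * X ^ i := ⟨_, rfl⟩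
  obtain ⟨E, hE⟩ : ∃ E : (wittFixed F p)[X], E = X ^ e - q := ⟨_, rfl⟩
  have hqdeg : q.degree < (e : WithBot ℕ) := by
    rw [hq]
    refine (degree_sum_le _ _).trans_lt ((Finset.sup_lt_iff (WithBot.bot_lt_coe e)).2 fun i hi => ?_)
    exact (degree_C_mul_X_pow_le i _).trans_lt (WithBot.coe_lt_coe.2 (Finset.mem_range.1 hi))
  have hXdeg : (X ^ e : (wittFixed F p)[X]).degree = e := degree_X_pow e
  have hEmonic : E.Monic := by
    rw [hE]
    exact (monic_X_pow e).sub_of_left (by rw [hXdeg]; exact hqdeg)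
  have hEdeg : E.degree = e := by
    rw [hE, degree_sub_eq_left_of_degree_lt (by rw [hXdeg]; exact hqdeg), hXdeg]
  have hEnat : E.natDegree = e := natDegree_eq_of_degree_eq_some hEdeg
  have hEcoeff : ∀ i < e, E.coeff i = -((p : wittFixed F p) * d i) := by
    intro i hi
    rw [hE, coeff_sub, coeff_X_pow, if_neg hi.ne, zero_sub, hq, finsetSum_coeff]
    simp only [coeff_C_mul_X_pow]
    rw [Finset.sum_ite_eq, if_pos (Finset.mem_range.2 hi)]
  -- `E(π) = 0`
  have hcast : ((π : 𝒪[F]) : F) ^ e =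
      (p : F) * ∑ i ∈ Finset.range e, wittFixedToF F p hp (d i) * ((π : 𝒪[F]) : F) ^ i := by
    have h2 := congrArg ((↑) : 𝒪[F] → F) hπe
    rw [hd, WittDigits.ofDigits] at h2
    push_cast at h2
    simpa only [coe_wittFixedToInt] using h2
  have heval : E.eval₂ (wittFixedToF F p hp) ((π : 𝒪[F]) : F) = 0 := by
    rw [hE, eval₂_sub, eval₂_X_pow, hq, eval₂_finsetSum]
    simp only [eval₂_mul, eval₂_C, eval₂_X_pow, eval₂_natCast, map_mul, map_natCast]
    rw [hcast, Finset.mul_sum, sub_eq_zero]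
    exact Finset.sum_congr rfl fun i _ => by ring
  -- `d₀` is a unit
  have hd0 : IsUnit (d 0) := by
    apply isUnit_of_isUnit_wittFixedToInt hp
    obtain ⟨e', rfl⟩ : ∃ e', e = e' + 1 := ⟨e - 1, (Nat.sub_add_cancel he).symm⟩
    have hsplit : ((u⁻¹ : (𝒪[F])ˣ) : 𝒪[F]) = wittFixedToInt F p hp (d 0) +
        π * ∑ i ∈ Finset.range e', wittFixedToInt F p hp (d (i + 1)) * π ^ i := by
      rw [hd, WittDigits.ofDigits, Finset.sum_range_succ', pow_zero, mul_one, add_comm, Finset.mul_sum]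
      congr 1
      exact Finset.sum_congr rfl fun i _ => by ring
    by_contra hnu
    have h1 : wittFixedToInt F p hp (d 0) ∈ 𝓂[F] := (IsLocalRing.mem_maximalIdeal _).2 hnu
    have h2 : ((u⁻¹ : (𝒪[F])ˣ) : 𝒪[F]) ∈ 𝓂[F] := by
      rw [hsplit]
      exact Ideal.add_mem _ h1 (Ideal.mul_mem_right _ _ hπm)
    exact (IsLocalRing.mem_maximalIdeal _).1 h2 (Units.isUnit u⁻¹)
  have hdvd : ∀ i < E.natDegree, (p : wittFixed F p) ∣ E.coeff i := by
    intro i hi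
    rw [hEnat] at hi
    rw [hEcoeff i hi]
    exact dvd_neg.2 (dvd_mul_right _ _)
  have hc0 : ∃ v : (wittFixed F p)ˣ, E.coeff 0 = (p : wittFixed F p) * v :=
    ⟨-hd0.unit, by rw [hEcoeff 0 he, Units.val_neg, IsUnit.unit_spec, mul_neg]⟩
  exact ⟨⟨E, hEmonic, hdvd, hc0, ((π : 𝒪[F]) : F), heval⟩, rfl,
    EisensteinRootW.coeff_toInt_surjective_of_ofDigits _ rfl (WittDigits.exists_eq_ofDigits hp hπ hpe)⟩

/-- ★★ **Hypothesis (H) of the `GL₁` files holds for every `p`-adic field**: for every `F/ℚ_p` with `|p|_F < 1` and every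
uniformizer `π`, every `ℚ_p`-conjugate `e ∘ χ_π` of the Lubin–Tate character `χ_π : Γ_F → 𝒪_F^×` (`e : F → F̄` a
`ℚ_p`-embedding other than the inclusion) is `ℂ_F`-admissible on the open subgroup `Γ_M` — it has a non-zero period
`u ∈ ℂ_F`, `σ(u) = e(χ_π(σ))·u` for `σ ∈ Γ_M` (`LubinTateCharacterConjugateAdmissible`).  From `𝒪_F = W(k_F)[π]`
(`exists_eisensteinRootW`) and the tree's `lubinTateCharacterConjugateAdmissible_of_coeff_surjective'`.
[cite: SerreAbelianLadic1968, Ch. III §A.4–A.5] [cite: FontaineAsterisque223III, Exp. II §1.5, Exp. III §3] -/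
theorem lubinTateCharacterConjugateAdmissible_holds (hp : valuation F p < 1) {π : 𝒪[F]}
    (hπ : (valuation F).IsUniformizer (π : F)) : LubinTateCharacterConjugateAdmissible F p hp hπ := by
  obtain ⟨D, hD, hsurj⟩ := exists_eisensteinRootW hp hπ
  exact lubinTateCharacterConjugateAdmissible_of_coeff_surjective' D hπ hD.symm hsurj

end Literature.NumberTheory.PAdicHodge

end
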